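import Summits.QuantumFields.YangMills.Theorems.DirichletWindowAllSidesChessboardEvenSchwarz
import Summits.QuantumFields.YangMills.Theorems.DirichletWindowAllSidesChessboardEven
import HarnessLib

/-!
# The chessboard estimate for plaquette sets of ALL orientations on the EVEN torus

Support file for item stmt-QuantumFields-20194 (`DirichletWindow.AllSidesCouplingChessboard`, K1 of the large-field
sparsity line; seat ym-dw-p1 g3).  Even-side companion of `…AllSidesChessboardOddTorusEstimate`.

For `L` even, continuous `ρ`, `0 ≤ c ≤ β` and an ARBITRARY finite set `P` of plaquettes of `(ℤ/L)^d`,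

  `⟨exp(c ∑_{q ∈ P} φ_q)⟩_{Λ,β} ≤ ⟨exp(c ∑_{all q} φ_q)⟩_{Λ,β} ^ (#P / L^d)`   (`wilsonExpectation_expObs_le_rpow_all_even`),

by the twisted two-class even estimate `twisted_chessboard_le_rpow_even_of_base`: the base LINK and SITE reflection
Cauchy–Schwarz inequalities of the axis `0` (`mpsiE_link_sq_le_zero`, `mpsiE_site_sq_le_zero`) are transported to every
axis by the axis exchange (`mpsiE_swap`), and to every hyperplane by translation invariance inside the abstract lemma.

HONEST FRAMING: finite-torus reflection-positivity bookkeeping over tree theorems; nothing here is a statement about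
the Yang–Mills mass gap or about infinite volume.  References: Fröhlich–Israel–Lieb–Simon, CMP 62 (1978) Thm. 4.1;
Fröhlich–Lieb, CMP 60 (1978) Thm. 2.2/2.3; Osterwalder–Seiler, Ann. Phys. 110 (1978) §2.
-/

noncomputable section

open MeasureTheory Finset
open Literature.MathematicalPhysics.QuantumFieldTheory
open Literature.MathematicalPhysics.QuantumFieldTheory.WilsonRP
open Literature.Barriers.CriticalPhenomena.NonGibbs
open Literature.Probability.LatticeModels
open Summit.QuantumFields.YangMills.Theorems.SoloBlind
open Summit.QuantumFields.YangMills.Theorems.OddTorusChessboard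

namespace Summit.QuantumFields.YangMills.Theorems.AllSidesChessboard

variable {d L N : ℕ} [NeZero d] [NeZero L] {G : Type*} [Group G] [TopologicalSpace G]
  [IsTopologicalGroup G] [CompactSpace G] [MeasurableSpace G] [BorelSpace G]
  (ρ : G →* Matrix (Fin N) (Fin N) ℂ)

/-! ### §1. The axis exchange conjugates the symmetrisations -/

section Swap

omit [NeZero L] in
/-- The axis exchange conjugates `cellReflect k a` into `cellReflect 0 a`. -/
theorem swapIdx_cellReflect' (k : Fin d) (a : ZMod L) (c : BlockIdx d L) :
    swapIdx k (cellReflect k a c) = cellReflect 0 a (swapIdx k c) := by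
  funext m
  rw [swapIdx_apply, cellReflect_apply, cellReflect_apply]
  by_cases hm : m = 0
  · subst hm
    rw [Equiv.swap_apply_left, Function.update_self, Function.update_self, swapIdx_apply, Equiv.swap_apply_left]
  · rw [Function.update_of_ne hm, swapIdx_apply]
    by_cases hmk : m = k
    · subst hmk
      rw [Equiv.swap_apply_right, Function.update_of_ne (Ne.symm hm)]
    · rw [Equiv.swap_apply_of_ne_of_ne hm hmk, Function.update_of_ne hmk]

omit [NeZero L] in
/-- The axis exchange conjugates `sreflect k j` into `sreflect 0 j`. -/
theorem swapIdx_sreflect (k : Fin d) (j : ZMod L) (c : BlockIdx d L) :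
    swapIdx k (sreflect k j c) = sreflect 0 j (swapIdx k c) := by
  funext m
  rw [swapIdx_apply, sreflect_apply, sreflect_apply]
  by_cases hm : m = 0
  · subst hm
    rw [Equiv.swap_apply_left, Function.update_self, Function.update_self, swapIdx_apply, Equiv.swap_apply_left]
  · rw [Function.update_of_ne hm, swapIdx_apply]
    by_cases hmk : m = k
    · subst hmk
      rw [Equiv.swap_apply_right, Function.update_of_ne (Ne.symm hm)]
    · rw [Equiv.swap_apply_of_ne_of_ne hm hmk, Function.update_of_ne hmk]

/-- `swapIdx k '' (symP k a B) = symP 0 a (swapIdx k '' B)`. -/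
theorem image_swapIdx_symP' (k : Fin d) (a : ZMod L) (B : Finset (BlockIdx d L)) :
    (symP k a B).image (swapIdx k) = symP 0 a (B.image (swapIdx k)) := by
  ext c
  simp only [symP, Finset.mem_image, Finset.mem_union, Finset.mem_inter, mem_halfPlus]
  constructor
  · rintro ⟨b, hb, rfl⟩
    rcases hb with ⟨hbA, hbC⟩ | ⟨b', ⟨hb'A, hb'C⟩, rfl⟩
    · exact Or.inl ⟨⟨b, hbA, rfl⟩, by simpa using hbC⟩
    · refine Or.inr ⟨swapIdx k b', ⟨⟨b', hb'A, rfl⟩, by simpa using hb'C⟩, ?_⟩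
      rw [swapIdx_cellReflect']
  · rintro (⟨⟨b, hbA, rfl⟩, hC⟩ | ⟨b', ⟨⟨b, hbA, rfl⟩, hbC⟩, hc⟩)
    · exact ⟨b, Or.inl ⟨hbA, by simpa using hC⟩, rfl⟩
    · refine ⟨cellReflect k a b, Or.inr ⟨b, ⟨hbA, by simpa using hbC⟩, rfl⟩, ?_⟩
      rw [swapIdx_cellReflect', hc]

/-- `swapIdx k '' (symM k a B) = symM 0 a (swapIdx k '' B)`. -/
theorem image_swapIdx_symM' (k : Fin d) (a : ZMod L) (B : Finset (BlockIdx d L)) :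
    (symM k a B).image (swapIdx k) = symM 0 a (B.image (swapIdx k)) := by
  ext c
  simp only [symM, Finset.mem_image, Finset.mem_union, Finset.mem_inter, mem_halfMinus]
  constructor
  · rintro ⟨b, hb, rfl⟩
    rcases hb with ⟨hbA, hbC⟩ | ⟨b', ⟨hb'A, hb'C⟩, rfl⟩
    · exact Or.inl ⟨⟨b, hbA, rfl⟩, by simpa using hbC⟩
    · refine Or.inr ⟨swapIdx k b', ⟨⟨b', hb'A, rfl⟩, by simpa using hb'C⟩, ?_⟩
      rw [swapIdx_cellReflect']
  · rintro (⟨⟨b, hbA, rfl⟩, hC⟩ | ⟨b', ⟨⟨b, hbA, rfl⟩, hbC⟩, hc⟩)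
    · exact ⟨b, Or.inl ⟨hbA, by simpa using hC⟩, rfl⟩
    · refine ⟨cellReflect k a b, Or.inr ⟨b, ⟨hbA, by simpa using hbC⟩, rfl⟩, ?_⟩
      rw [swapIdx_cellReflect', hc]

/-- `swapIdx k '' (ssymP k j B) = ssymP 0 j (swapIdx k '' B)`. -/
theorem image_swapIdx_ssymP (k : Fin d) (j : ZMod L) (B : Finset (BlockIdx d L)) :
    (ssymP k j B).image (swapIdx k) = ssymP 0 j (B.image (swapIdx k)) := by
  ext c
  simp only [ssymP, Finset.mem_image, Finset.mem_union, Finset.mem_inter, mem_shalfP]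
  constructor
  · rintro ⟨b, hb, rfl⟩
    rcases hb with ⟨hbA, hbC⟩ | ⟨b', ⟨hb'A, hb'C⟩, rfl⟩
    · exact Or.inl ⟨⟨b, hbA, rfl⟩, by simpa using hbC⟩
    · refine Or.inr ⟨swapIdx k b', ⟨⟨b', hb'A, rfl⟩, by simpa using hb'C⟩, ?_⟩
      rw [swapIdx_sreflect]
  · rintro (⟨⟨b, hbA, rfl⟩, hC⟩ | ⟨b', ⟨⟨b, hbA, rfl⟩, hbC⟩, hc⟩)
    · exact ⟨b, Or.inl ⟨hbA, by simpa using hC⟩, rfl⟩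
    · refine ⟨sreflect k j b, Or.inr ⟨b, ⟨hbA, by simpa using hbC⟩, rfl⟩, ?_⟩
      rw [swapIdx_sreflect, hc]

/-- `swapIdx k '' (ssymM k j B) = ssymM 0 j (swapIdx k '' B)`. -/
theorem image_swapIdx_ssymM (k : Fin d) (j : ZMod L) (B : Finset (BlockIdx d L)) :
    (ssymM k j B).image (swapIdx k) = ssymM 0 j (B.image (swapIdx k)) := by
  ext c
  simp only [ssymM, Finset.mem_image, Finset.mem_union, Finset.mem_inter, mem_shalfM]
  constructor
  · rintro ⟨b, hb, rfl⟩
    rcases hb with ⟨hbA, hbC⟩ | ⟨b', ⟨hb'A, hb'C⟩, rfl⟩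
    · exact Or.inl ⟨⟨b, hbA, rfl⟩, by simpa using hbC⟩
    · refine Or.inr ⟨swapIdx k b', ⟨⟨b', hb'A, rfl⟩, by simpa using hb'C⟩, ?_⟩
      rw [swapIdx_sreflect]
  · rintro (⟨⟨b, hbA, rfl⟩, hC⟩ | ⟨b', ⟨⟨b, hbA, rfl⟩, hbC⟩, hc⟩)
    · exact ⟨b, Or.inl ⟨hbA, by simpa using hC⟩, rfl⟩
    · refine ⟨sreflect k j b, Or.inr ⟨b, ⟨hbA, by simpa using hbC⟩, rfl⟩, ?_⟩
      rw [swapIdx_sreflect, hc]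

end Swap

/-! ### §2. The LINK and SITE Schwarz inequalities in every axis -/

section AllAxes

/-- Generic transport of an axis-`0` Schwarz inequality to the axis `k` by the axis exchange. -/
theorem mpsiE_sq_le_of_zero (hρ : Continuous ρ) (β c : ℝ) (k : Fin d)
    (SP SM TP TM : Finset (BlockIdx d L) → Finset (BlockIdx d L))
    (SP₀ SM₀ TP₀ TM₀ : Finset (BlockIdx d L) → Finset (BlockIdx d L))
    (hSP : ∀ B, (SP B).image (swapIdx k) = SP₀ (B.image (swapIdx k)))
    (hSM : ∀ B, (SM B).image (swapIdx k) = SM₀ (B.image (swapIdx k)))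
    (hTP : ∀ B, (TP B).image (swapIdx k) = TP₀ (B.image (swapIdx k)))
    (hTM : ∀ B, (TM B).image (swapIdx k) = TM₀ (B.image (swapIdx k)))
    (hzero : ∀ A' : Orient d → Finset (BlockIdx d L), mpsiE (G := G) ρ β c A' ^ 2 ≤
      mpsiE ρ β c (fun o => if o.1.1 = 0 then SP₀ (A' o) else TP₀ (A' o)) *
        mpsiE ρ β c (fun o => if o.1.1 = 0 then SM₀ (A' o) else TM₀ (A' o)))
    (A : Orient d → Finset (BlockIdx d L)) :
    mpsiE (G := G) ρ β c A ^ 2 ≤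
      mpsiE ρ β c (fun o => if InPlane o k then SP (A o) else TP (A o)) *
        mpsiE ρ β c (fun o => if InPlane o k then SM (A o) else TM (A o)) := by
  set A' : Orient d → Finset (BlockIdx d L) := fun o => (A (oSwap (L := L) k o)).image (swapIdx k) with hA'
  have h := hzero A'
  have e0 : mpsiE (G := G) ρ β c A' = mpsiE ρ β c A := mpsiE_swap ρ hρ β c k A
  have h01 : ∀ o : Orient d, InPlane o 0 ↔ o.1.1 = 0 := fun o =>
    ⟨fun h => h.elim id fun h => absurd (h ▸ o.2) (by simp), fun h => Or.inl h⟩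
  have hcond' : ∀ o : Orient d, o.1.1 = 0 ↔ InPlane (oSwap (L := L) k o) k := by
    intro o
    rw [← h01, inPlane_oSwap, Equiv.swap_apply_right]
  have e1 : mpsiE (G := G) ρ β c (fun o => if o.1.1 = 0 then SP₀ (A' o) else TP₀ (A' o)) =
      mpsiE ρ β c (fun o => if InPlane o k then SP (A o) else TP (A o)) := by
    rw [← mpsiE_swap ρ hρ β c k (fun o => if InPlane o k then SP (A o) else TP (A o))]
    congr 1
    funext o
    by_cases ho : o.1.1 = 0
    · rw [if_pos ho, if_pos ((hcond' o).1 ho), hA', hSP]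
    · rw [if_neg ho, if_neg (fun h => ho ((hcond' o).2 h)), hA', hTP]
  have e2 : mpsiE (G := G) ρ β c (fun o => if o.1.1 = 0 then SM₀ (A' o) else TM₀ (A' o)) =
      mpsiE ρ β c (fun o => if InPlane o k then SM (A o) else TM (A o)) := by
    rw [← mpsiE_swap ρ hρ β c k (fun o => if InPlane o k then SM (A o) else TM (A o))]
    congr 1
    funext o
    by_cases ho : o.1.1 = 0
    · rw [if_pos ho, if_pos ((hcond' o).1 ho), hA', hSM]
    · rw [if_neg ho, if_neg (fun h => ho ((hcond' o).2 h)), hA', hTM]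
  rw [e0, e1, e2] at h
  exact h

/-- **The LINK Schwarz inequality of `Ψ` in the axis `k`** (`L` even, `0 ≤ c ≤ β`). -/
theorem mpsiE_link_sq_le (hL : Even L) (hρ : Continuous ρ) {β c : ℝ} (hc : 0 ≤ c) (hcβ : c ≤ β) (k : Fin d)
    (A : Orient d → Finset (BlockIdx d L)) :
    mpsiE (G := G) ρ β c A ^ 2 ≤
      mpsiE ρ β c (fun o => if InPlane o k then ssymP k 0 (A o) else symP k 1 (A o)) *
        mpsiE ρ β c (fun o => if InPlane o k then ssymM k 0 (A o) else symM k 1 (A o)) :=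
  mpsiE_sq_le_of_zero ρ hρ β c k (ssymP k 0) (ssymM k 0) (symP k 1) (symM k 1)
    (ssymP 0 0) (ssymM 0 0) (symP 0 1) (symM 0 1)
    (image_swapIdx_ssymP k 0) (image_swapIdx_ssymM k 0) (image_swapIdx_symP' k 1) (image_swapIdx_symM' k 1)
    (fun A' => mpsiE_link_sq_le_zero ρ hL hρ hc hcβ A') A

/-- **The SITE Schwarz inequality of `Ψ` in the axis `k`** (`L` even). -/
theorem mpsiE_site_sq_le (hL : Even L) (hρ : Continuous ρ) (β c : ℝ) (k : Fin d)
    (A : Orient d → Finset (BlockIdx d L)) :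
    mpsiE (G := G) ρ β c A ^ 2 ≤
      mpsiE ρ β c (fun o => if InPlane o k then symP k 0 (A o) else ssymP k 0 (A o)) *
        mpsiE ρ β c (fun o => if InPlane o k then symM k 0 (A o) else ssymM k 0 (A o)) :=
  mpsiE_sq_le_of_zero ρ hρ β c k (symP k 0) (symM k 0) (ssymP k 0) (ssymM k 0)
    (symP 0 0) (symM 0 0) (ssymP 0 0) (ssymM 0 0)
    (image_swapIdx_symP' k 0) (image_swapIdx_symM' k 0) (image_swapIdx_ssymP k 0) (image_swapIdx_ssymM k 0)
    (fun A' => mpsiE_site_sq_le_zero ρ hL hρ β c A') A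

end AllAxes

/-! ### §3. The chessboard estimate for arbitrary plaquette sets on the even torus -/

section Main

/-- **`Ψ(A) ≤ Ψ(⊤) ^ (size A / L^d)`** on the even torus — the twisted two-class even estimate applied to `Ψ`. -/
theorem mpsiE_le_rpow (hL : Even L) (hρ : Continuous ρ) {β c : ℝ} (hc : 0 ≤ c) (hcβ : c ≤ β)
    (A : Orient d → Finset (BlockIdx d L)) :
    mpsiE (G := G) ρ β c A ≤
      mpsiE ρ β c (fun _ => (univ : Finset (BlockIdx d L))) ^ (((∑ o, #(A o) : ℕ) : ℝ) / (L : ℝ) ^ d) := by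
  classical
  have h1 : 0 < mpsiE (G := G) ρ β c (fun _ : Orient d => (univ : Finset (BlockIdx d L))) :=
    lt_of_lt_of_le one_pos (one_le_wilsonExpectation_expObs ρ hρ β hc _)
  refine twisted_chessboard_le_rpow_even_of_base (cls := fun k o => decide (InPlane o k)) hL
    (fun A => mpsiE_nonneg ρ β c A) h1 (fun i a A => mpsiE_translate ρ β c i a A) (fun i A => ?_) (fun i A => ?_)
    (fun T => ?_) A
  · have h := mpsiE_link_sq_le ρ hL hρ hc hcβ i A
    simp only [decide_eq_true_eq]
    exact h
  · have h := mpsiE_site_sq_le ρ hL hρ β c i A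
    simp only [decide_eq_true_eq]
    exact h
  · by_cases hT : T = ∅
    · subst hT
      haveI := isProbabilityMeasure_wilsonMeasure (d := d) (L := L) (G := G) ρ hρ β
      have : plaqsE (fun o : Orient d => if o ∈ (∅ : Finset (Orient d)) then (univ : Finset (BlockIdx d L)) else ∅) =
          ∅ := by
        ext q; simp [mem_plaqsE]
      simp only [card_empty, pow_zero]
      unfold mpsiE wilsonExpectation
      rw [this]
      simp [expObs]
    · have hle : mpsiE (G := G) ρ β c (fun o => if o ∈ T then (univ : Finset (BlockIdx d L)) else ∅) ≤
          mpsiE ρ β c (fun _ : Orient d => (univ : Finset (BlockIdx d L))) := by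
        unfold mpsiE
        refine wilsonExpectation_expObs_mono ρ hρ hc β ?_
        rw [plaqsE_top]; exact subset_univ _
      refine hle.trans ?_
      have h1' : 1 ≤ mpsiE (G := G) ρ β c (fun _ : Orient d => (univ : Finset (BlockIdx d L))) :=
        one_le_wilsonExpectation_expObs ρ hρ β hc _
      calc mpsiE (G := G) ρ β c (fun _ : Orient d => (univ : Finset (BlockIdx d L)))
          = mpsiE ρ β c (fun _ : Orient d => (univ : Finset (BlockIdx d L))) ^ 1 := (pow_one _).symm
        _ ≤ mpsiE ρ β c (fun _ : Orient d => (univ : Finset (BlockIdx d L))) ^ #T :=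
            pow_le_pow_right₀ h1' (Nat.one_le_iff_ne_zero.2 fun h => hT (card_eq_zero.1 h))

/-- **The chessboard estimate on the EVEN torus for an ARBITRARY finite set of plaquettes** (every orientation at
once): for `L` even, continuous `ρ`, `0 ≤ c ≤ β` and `P ⊆` plaquettes of `(ℤ/L)^d`,
`⟨exp(c ∑_{q ∈ P} φ_q)⟩_{Λ,β} ≤ ⟨exp(c ∑_{all q} φ_q)⟩_{Λ,β} ^ (#P / L^d)`. -/
theorem wilsonExpectation_expObs_le_rpow_all_even (hL : Even L) (hρ : Continuous ρ) {β c : ℝ}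
    (hc : 0 ≤ c) (hcβ : c ≤ β) (P : Finset (Plaquette d L)) :
    wilsonExpectation ρ β (expObs (G := G) ρ c P) ≤
      wilsonExpectation ρ β (expObs (G := G) ρ c (univ : Finset (Plaquette d L))) ^ ((#P : ℝ) / (L : ℝ) ^ d) := by
  obtain ⟨A, hA, hcard⟩ := exists_plaqsE_eq P
  have h := mpsiE_le_rpow ρ hL hρ hc hcβ A
  rw [mpsiE, mpsiE, hA, plaqsE_top, hcard] at h
  exact h

end Main

end Summit.QuantumFields.YangMills.Theorems.AllSidesChessboard

end
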